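import Summits.Ventures.HodgeRepro2.T5SU11LegendreGenerating
import Summits.Ventures.HodgeRepro2.T5SU11LegendreBound

/-!
# The generating function on `[−1, 1]`: `Σ_n P_n(x) rⁿ = (1 − 2xr + r²)^{−1/2}` for `|x| ≤ 1`, `|r| < 1`,
and on the circle `Σ_n P_n(cos θ) rⁿ = 1/√(1 − 2r cos θ + r²)`

Row 379 (`T5SU11LegendreGenerating`) proved the generating function for `x ≥ 1`, `0 ≤ r < 1/ρ(x)`, where every term is
non-negative. Its algebraic core — the Cauchy product and the three-term recursion of the convolution squares
(`T5SU11LegendreGeneratingFormal`) — only needs the absolute convergence of `Σ_n P_n(x) rⁿ`; it is re-run here under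
that hypothesis alone (`legGen_sq_mul_of_summable`: `S_x(r)² · (1 − 2xr + r²) = 1`). On `[−1, 1]` the bound
`|P_n| ≤ 1` (row 385) gives absolute convergence for `|r| < 1` (`summable_norm_legP_mul_pow_of_mem_Icc`), and
`1 − 2xr + r² ≥ (1 − |r|)² > 0`. The sign is fixed by continuity: `r ↦ S_x(r)` is continuous on `[−r₀, r₀]`
(`continuousOn_legGen`, Mathlib's `continuousOn_tsum`), never vanishes, and `S_x(0) = 1`, so `S_x(r) > 0`
(`legGen_pos`) — the intermediate value theorem on the segment `[[0, r]]`. Hence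

  **`Σ_n P_n(x) rⁿ = 1/√(1 − 2xr + r²)` for `x ∈ [−1, 1]`, `|r| < 1`**   (`tsum_legP_mul_pow_of_mem_Icc`),
  **`Σ_n P_n(cos θ) rⁿ = 1/√(1 − 2r cos θ + r²)` for every `θ`, `|r| < 1`**   (`tsum_legP_cos_mul_pow`),

the classical expansion of the Newtonian potential `1/|1 − r e^{iθ}|`; at `x = ±1` the geometric series. Nothing is
claimed about (N).

Blind lane: Mathlib + the HodgeRepro2 prefix only; no sorry; axioms ⊆ {propext, Classical.choice,
Quot.sound}.
-/

namespace Summit.Ventures.HodgeRepro2.T5SU11LegendreGeneratingCircle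

open MeasureTheory Metric Set Filter Topology Finset
open T5SU11SphericalLegendreAll T5SU11SphericalLegendreLaplace T5SU11LegendreGeneratingFormal
  T5SU11LegendreGenerating T5SU11LegendreBound

/-! ### The algebraic core under absolute convergence alone -/

/-- The Cauchy product `S_x(r)² = Σ_n q_n rⁿ`, `q_n = Σ_{i+j=n} P_i(x) P_j(x)`, under absolute convergence. -/
theorem legGen_mul_legGen_of_summable {x r : ℝ} (h : Summable fun n => ‖legP n x * r ^ n‖) :
    legGen x r * legGen x r = ∑' n, PowerSeries.coeff n (legSeries x * legSeries x) * r ^ n := by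
  unfold legGen
  rw [tsum_mul_tsum_eq_tsum_sum_antidiagonal_of_summable_norm h h]
  refine tsum_congr fun n => ?_
  rw [coeff_legSeries_sq, Finset.sum_mul]
  refine Finset.sum_congr rfl fun ij hij => ?_
  rw [← Finset.HasAntidiagonal.mem_antidiagonal.mp hij, pow_add]
  ring

/-- `Σ_n q_n rⁿ` converges under absolute convergence of `Σ_n P_n(x) rⁿ`. -/
theorem summable_coeff_sq_mul_pow_of_summable {x r : ℝ} (h : Summable fun n => ‖legP n x * r ^ n‖) :
    Summable fun n => PowerSeries.coeff n (legSeries x * legSeries x) * r ^ n := by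
  have h' := (summable_norm_sum_mul_antidiagonal_of_summable_norm h h).of_norm
  refine h'.congr fun n => ?_
  rw [coeff_legSeries_sq, Finset.sum_mul]
  refine Finset.sum_congr rfl fun ij hij => ?_
  rw [← Finset.HasAntidiagonal.mem_antidiagonal.mp hij, pow_add]
  ring

/-- **`S_x(r)² · (1 − 2xr + r²) = 1`** whenever `Σ_n P_n(x) rⁿ` converges absolutely. -/
theorem legGen_sq_mul_of_summable {x r : ℝ} (h : Summable fun n => ‖legP n x * r ^ n‖) :
    legGen x r ^ 2 * (1 - 2 * x * r + r ^ 2) = 1 := by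
  rw [sq, legGen_mul_legGen_of_summable h]
  obtain ⟨u, hu_def⟩ : ∃ u : ℕ → ℝ, (fun n => PowerSeries.coeff n (legSeries x * legSeries x) * r ^ n) = u :=
    ⟨_, rfl⟩
  have hu_app : ∀ n, u n = PowerSeries.coeff n (legSeries x * legSeries x) * r ^ n := fun n => by
    rw [← hu_def]
  rw [show (∑' n, PowerSeries.coeff n (legSeries x * legSeries x) * r ^ n) = ∑' n, u n by rw [← hu_def]]
  have hu : Summable u := hu_def ▸ summable_coeff_sq_mul_pow_of_summable h
  have hu1 : Summable fun n => u (n + 1) := (summable_nat_add_iff 1).mpr hu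
  have hu2 : Summable fun n => u (n + 2) := (summable_nat_add_iff 2).mpr hu
  have e0 : ∑' n, u n = u 0 + ∑' n, u (n + 1) := hu.tsum_eq_zero_add
  have e1 : ∑' n, u (n + 1) = u 1 + ∑' n, u (n + 2) := hu1.tsum_eq_zero_add
  have hz : ∀ n, u (n + 2) - 2 * x * r * u (n + 1) + r ^ 2 * u n = 0 := fun n => by
    have h := coeff_legSeries_sq_recursion x n
    rw [hu_app, hu_app, hu_app]
    calc PowerSeries.coeff (n + 2) (legSeries x * legSeries x) * r ^ (n + 2)
          - 2 * x * r * (PowerSeries.coeff (n + 1) (legSeries x * legSeries x) * r ^ (n + 1))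
          + r ^ 2 * (PowerSeries.coeff n (legSeries x * legSeries x) * r ^ n)
        = r ^ (n + 2) * (PowerSeries.coeff (n + 2) (legSeries x * legSeries x)
            - 2 * x * PowerSeries.coeff (n + 1) (legSeries x * legSeries x)
            + PowerSeries.coeff n (legSeries x * legSeries x)) := by ring
      _ = 0 := by rw [h, mul_zero]
  have hsum : ∑' n, (u (n + 2) - 2 * x * r * u (n + 1) + r ^ 2 * u n) = 0 := by
    simp only [hz, tsum_zero]
  rw [Summable.tsum_add (hu2.sub (hu1.mul_left _)) (hu.mul_left _), Summable.tsum_sub hu2 (hu1.mul_left _),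
    tsum_mul_left, tsum_mul_left] at hsum
  have hu0 : u 0 = 1 := by rw [hu_app, coeff_legSeries_sq_zero, pow_zero, mul_one]
  have hu1' : u 1 = 2 * x * r := by rw [hu_app, coeff_legSeries_sq_one, pow_one]
  linear_combination (1 - 2 * x * r) * e0 + e1 + hsum + (1 - 2 * x * r) * hu0 + hu1'

/-! ### Absolute convergence and the quadratic on `[−1, 1]` -/

/-- **`Σ_n P_n(x) rⁿ` converges absolutely** for `x ∈ [−1, 1]`, `|r| < 1` (`|P_n(x) rⁿ| ≤ |r|ⁿ`). -/
theorem summable_norm_legP_mul_pow_of_mem_Icc {x r : ℝ} (hx : x ∈ Icc (-1 : ℝ) 1) (hr : |r| < 1) :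
    Summable fun n => ‖legP n x * r ^ n‖ := by
  refine Summable.of_nonneg_of_le (fun n => norm_nonneg _) (fun n => ?_)
    (summable_geometric_of_lt_one (abs_nonneg r) hr)
  rw [Real.norm_eq_abs, abs_mul, abs_pow]
  exact mul_le_of_le_one_left (pow_nonneg (abs_nonneg r) n) (abs_legP_le_one n hx)

/-- **`1 − 2xr + r² ≥ (1 − |r|)² > 0`** for `|x| ≤ 1`, `|r| < 1`. -/
theorem quad_pos_of_mem_Icc {x r : ℝ} (hx : x ∈ Icc (-1 : ℝ) 1) (hr : |r| < 1) : 0 < 1 - 2 * x * r + r ^ 2 := by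
  have hxr : x * r ≤ |r| := by
    calc x * r ≤ |x * r| := le_abs_self _
      _ = |x| * |r| := abs_mul _ _
      _ ≤ 1 * |r| := mul_le_mul_of_nonneg_right (abs_le.mpr ⟨hx.1, hx.2⟩) (abs_nonneg r)
      _ = |r| := one_mul _
  have h1 : 0 < 1 - |r| := by linarith
  have h2 : 0 < (1 - |r|) ^ 2 := pow_pos h1 2
  nlinarith [sq_abs r]

/-! ### Continuity in `r` and the sign -/

/-- **`r ↦ S_x(r)` is continuous on `[−r₀, r₀]`** for `x ∈ [−1, 1]`, `r₀ < 1`. -/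
theorem continuousOn_legGen {x : ℝ} (hx : x ∈ Icc (-1 : ℝ) 1) {r₀ : ℝ} (hr₀0 : 0 ≤ r₀) (hr₀ : r₀ < 1) :
    ContinuousOn (fun r => legGen x r) (Icc (-r₀) r₀) := by
  unfold legGen
  refine continuousOn_tsum (fun n => (continuous_const.mul (continuous_pow n)).continuousOn)
    (summable_geometric_of_lt_one hr₀0 hr₀) fun n r hr => ?_
  rw [Real.norm_eq_abs, abs_mul, abs_pow]
  have hr' : |r| ≤ r₀ := abs_le.mpr ⟨hr.1, hr.2⟩
  calc |legP n x| * |r| ^ n ≤ 1 * r₀ ^ n :=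
        mul_le_mul (abs_legP_le_one n hx) (pow_le_pow_left₀ (abs_nonneg r) hr' n) (pow_nonneg (abs_nonneg r) n)
          zero_le_one
    _ = r₀ ^ n := one_mul _

/-- `S_x(0) = 1`. -/
theorem legGen_zero (x : ℝ) : legGen x 0 = 1 := by
  unfold legGen
  rw [tsum_eq_single 0 fun n hn => by simp [hn]]
  simp

/-- `S_x(r) ≠ 0` for `x ∈ [−1, 1]`, `|r| < 1`. -/
theorem legGen_ne_zero {x r : ℝ} (hx : x ∈ Icc (-1 : ℝ) 1) (hr : |r| < 1) : legGen x r ≠ 0 := by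
  intro h0
  have := legGen_sq_mul_of_summable (summable_norm_legP_mul_pow_of_mem_Icc hx hr)
  rw [h0] at this
  norm_num at this

/-- **`S_x(r) > 0`** for `x ∈ [−1, 1]`, `|r| < 1` (continuity from `S_x(0) = 1` along the segment `[[0, r]]`). -/
theorem legGen_pos {x r : ℝ} (hx : x ∈ Icc (-1 : ℝ) 1) (hr : |r| < 1) : 0 < legGen x r := by
  by_contra hle
  push Not at hle
  have hne := legGen_ne_zero hx hr
  have hlt : legGen x r < 0 := lt_of_le_of_ne hle hne
  have hcont : ContinuousOn (fun s => legGen x s) (uIcc 0 r) := by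
    refine (continuousOn_legGen hx (abs_nonneg r) hr).mono fun s hs => ?_
    rw [Set.uIcc_eq_union] at hs
    rcases hs with hs | hs
    · exact ⟨by linarith [hs.1, abs_nonneg r], hs.2.trans (le_abs_self r)⟩
    · exact ⟨hs.1.trans' (neg_abs_le r), by linarith [hs.2, abs_nonneg r]⟩
  have h0 : (0 : ℝ) ∈ uIcc (legGen x 0) (legGen x r) := by
    rw [legGen_zero]
    exact Set.mem_uIcc.mpr (Or.inr ⟨hlt.le, zero_le_one⟩)
  obtain ⟨c, hc, hc0⟩ := intermediate_value_uIcc hcont h0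
  have hcr : |c| < 1 := by
    rw [Set.uIcc_eq_union] at hc
    rcases hc with hc | hc
    · exact abs_lt.mpr ⟨by linarith [hc.1, neg_abs_le r, (abs_lt.mp hr).1], lt_of_le_of_lt hc.2 (lt_of_le_of_lt (le_abs_self r) hr)⟩
    · exact abs_lt.mpr ⟨lt_of_lt_of_le (abs_lt.mp hr).1 hc.1, by linarith [hc.2]⟩
  exact legGen_ne_zero hx hcr hc0

/-! ### The generating function on `[−1, 1]` and on the circle -/

/-- **`Σ_n P_n(x) rⁿ = 1/√(1 − 2xr + r²)`** for `x ∈ [−1, 1]`, `|r| < 1`. -/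
theorem legGen_eq_of_mem_Icc {x r : ℝ} (hx : x ∈ Icc (-1 : ℝ) 1) (hr : |r| < 1) :
    legGen x r = 1 / Real.sqrt (1 - 2 * x * r + r ^ 2) := by
  have hq := quad_pos_of_mem_Icc hx hr
  have hS := legGen_pos hx hr
  have h := legGen_sq_mul_of_summable (summable_norm_legP_mul_pow_of_mem_Icc hx hr)
  rw [eq_div_iff (Real.sqrt_pos.mpr hq).ne']
  have : (legGen x r * Real.sqrt (1 - 2 * x * r + r ^ 2)) ^ 2 = 1 := by
    rw [mul_pow, Real.sq_sqrt hq.le, h]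
  have hpos : 0 < legGen x r * Real.sqrt (1 - 2 * x * r + r ^ 2) := mul_pos hS (Real.sqrt_pos.mpr hq)
  nlinarith [this, hpos]

/-- The same, spelled out. -/
theorem tsum_legP_mul_pow_of_mem_Icc {x r : ℝ} (hx : x ∈ Icc (-1 : ℝ) 1) (hr : |r| < 1) :
    ∑' n, legP n x * r ^ n = 1 / Real.sqrt (1 - 2 * x * r + r ^ 2) :=
  legGen_eq_of_mem_Icc hx hr

/-- **On the circle: `Σ_n P_n(cos θ) rⁿ = 1/√(1 − 2r cos θ + r²)`** for every `θ`, `|r| < 1`. -/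
theorem tsum_legP_cos_mul_pow (θ : ℝ) {r : ℝ} (hr : |r| < 1) :
    ∑' n, legP n (Real.cos θ) * r ^ n = 1 / Real.sqrt (1 - 2 * r * Real.cos θ + r ^ 2) := by
  rw [tsum_legP_mul_pow_of_mem_Icc ⟨Real.neg_one_le_cos θ, Real.cos_le_one θ⟩ hr]
  ring_nf

/-- The cross-check `x = −1`: `Σ_n (−1)ⁿ rⁿ = 1/(1 + r)`. -/
theorem tsum_legP_neg_one_mul_pow {r : ℝ} (hr : |r| < 1) : ∑' n, legP n (-1) * r ^ n = 1 / (1 + r) := by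
  rw [tsum_legP_mul_pow_of_mem_Icc ⟨le_rfl, by norm_num⟩ hr]
  have h1 : 0 < 1 + r := by linarith [(abs_lt.mp hr).1]
  rw [show (1 : ℝ) - 2 * (-1) * r + r ^ 2 = (1 + r) ^ 2 by ring, Real.sqrt_sq h1.le]

/-- The absolute convergence on `[−1, 1]`, spelled out. -/
theorem summable_legP_mul_pow_of_mem_Icc {x r : ℝ} (hx : x ∈ Icc (-1 : ℝ) 1) (hr : |r| < 1) :
    Summable fun n => legP n x * r ^ n :=
  (summable_norm_legP_mul_pow_of_mem_Icc hx hr).of_norm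

end Summit.Ventures.HodgeRepro2.T5SU11LegendreGeneratingCircle
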